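import Literature.NumberTheory.EllipticCurves.TorsionRationalDescentProofs
import Literature.NumberTheory.EllipticCurves.WeierstrassFieldOfModuliProofs
import HarnessLib

/-!
# Automorphisms are `±1` for `j ≠ 0, 1728`; isomorphisms between `k`-models differ by quadratic twists
# ([IUTchIV] Prop. 1.8 (ii), (iii) in real form)

`Proofs` file (theorems only; no definitions, no named facts, no instances) in topic
`NumberTheory/EllipticCurves`, companion of `TorsionRationalDescentProofs` (the cocycle
`σ ↦ C⁻¹σ(C)` of a change of variables over `L` between two curves over `k`; [IUTchIV] Prop. 1.8 (iv)
in real form), `WeierstrassFieldOfModuliProofs` (abc-iut-w5-d047: Prop. 1.8 (ii), (iii) in real form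
— field of moduli `k(j)`, `u = ±1` for `j ≠ 0, 1728`, `ρ₂` factors through `G_E`) and
`WeierstrassAutFixedTorsionProofs` (the automorphisms with `u = ±1`). Written by
the cell `abc-iut` (seat abc-iut-L5-t12). S. Mochizuki, *Inter-universal Teichmüller theory IV*,
Prop. 1.8 (ii), (iii) (kurims Apr-2020 manuscript, pp. 18–19): "(ii) … The finite extension `k_E` of
`k` determined by `G_E` is the minimal field of definition of `E_k̄`, i.e., the field generated over
`k` by the `j`-invariant of `E_k̄` … (iii) suppose further that `Aut_k̄(E_k̄) = {±1}`. Then the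
representation `ρ_2` factors through `G_E` and hence defines a natural representation
`G_E → Aut(E_k̄[2])`" — used in Thm. 1.10 (p. 22) to define the tripodal field
`F_tpd := F_mod(E_{F_mod}[2])` from "the `2`-torsion points of ANY model of `E_F ×_F F̄` over
`F_mod`". The classical content proved here, for Weierstrass equations (Silverman *AEC* III.10.1,
X.5.4):

* `VariableChange.eq_one_or_eq_neg_of_smul_eq` — in characteristic `∤ 6`, for `j ≠ 0, 1728`:
  `Aut(V) = {1, [−1]}` with `[−1] = (−1, 0, −a₁, −a₃)` (from the tree's
  `u_eq_one_or_neg_one_of_j_ne`, abc-iut-w5-d047's `WeierstrassFieldOfModuliProofs`, and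
  `r_s_t_of_smul_eq_of_u_eq_neg_one`; Silverman *AEC* III.10.1);
* `VariableChange.exists_u_sq_eq_algebraMap_of_smul_baseChange` — **quadratic-twist descent**: if
  `C • W₁/L = W₂/L` for elliptic curves `W₁, W₂` over `k` with `j ≠ 0, 1728`, `L/k` Galois,
  `char ∤ 6`, then `u(C)² ∈ k` and `r(C) ∈ k` (the cocycle `C⁻¹σ(C)` is `±1`, and
  `(C·[−1]).u = −u`, `(C·[−1]).r = r`): the abscissa of the isomorphism, `x ↦ u⁻²(x − r)`, is
  DEFINED OVER `k` — so the `x`-coordinates of the `n`-torsion points of any two `k`-models generate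
  the same field over `k` ((iii): "`ρ_2` factors through `G_E`"), which is what makes
  `F_tpd = F_mod(E_{F_mod}[2])` independent of the model.

## References

* [Mochizuki2012] S. Mochizuki, IUT IV, Prop. 1.8 (ii), (iii) pp. 18–19; Thm. 1.10 p. 22.
* [SilvermanAEC2009] J. H. Silverman, *The Arithmetic of Elliptic Curves*, 2nd ed.: III.1 Table 3.1
  (`u⁴c₄' = c₄`, `u⁶c₆' = c₆`), Thm. III.10.1, Prop. X.5.4 (twists for `j ≠ 0, 1728` are quadratic).
-/

noncomputable section

open scoped Classical

universe u v

namespace WeierstrassCurve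

open Literature.NumberTheory.EllipticCurves

/-! ## §1. `Aut = {±1}` for `j ≠ 0, 1728` -/

section Aut

variable {K : Type u} [Field K] (V : WeierstrassCurve K)

/-- **`Aut(V) = {1, [−1]}` for `j ≠ 0, 1728` in characteristic `∤ 6`**: an automorphism `A • V = V`
of an elliptic Weierstrass equation with `j(V) ≠ 0, 1728` is the identity or the negation
`[−1] = (−1, 0, −a₁, −a₃)` (Silverman *AEC* III.10.1; tree: `u_eq_one_or_neg_one_of_j_ne`,
`eq_one_of_smul_eq_of_u_eq_one`, `r_s_t_of_smul_eq_of_u_eq_neg_one`).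
[cite: SilvermanAEC2009, III.10 Thm. 10.1] -/
theorem VariableChange.eq_one_or_eq_neg_of_smul_eq [V.IsElliptic] (h2 : (2 : K) ≠ 0) (h3 : (3 : K) ≠ 0)
    (hj0 : V.j ≠ 0) (hj : V.j ≠ 1728) {A : VariableChange K} (hA : A • V = V) :
    A = 1 ∨ A = ⟨-1, 0, -V.a₁, -V.a₃⟩ := by
  rcases VariableChange.u_eq_one_or_neg_one_of_j_ne V hj0 hj hA with hu | hu
  · exact Or.inl (VariableChange.eq_one_of_smul_eq_of_u_eq_one V h2 h3 hA hu)
  · right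
    obtain ⟨hr, hs, ht⟩ := VariableChange.r_s_t_of_smul_eq_of_u_eq_neg_one V h2 h3 hA hu
    ext
    · rw [hu]
    · exact hr
    · exact hs
    · exact ht

end Aut

/-! ## §2. Quadratic-twist descent of an isomorphism between two `k`-models (`j ≠ 0, 1728`) -/

section Descent

variable {k : Type u} {L : Type v} [Field k] [Field L] [Algebra k L] [IsGalois k L]
  (W₁ W₂ : WeierstrassCurve k) [W₁.IsElliptic]

/-- **Isomorphic `k`-models with `j ≠ 0, 1728` differ by a QUADRATIC twist** (Silverman *AEC* X.5.4;
the content of [IUTchIV] Prop. 1.8 (ii)/(iii) used on p. 22 to define `F_tpd` from "any model"):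
if `C • W₁/L = W₂/L` over a Galois extension `L/k` (characteristic `∤ 6`), then `u(C)² ∈ k` and
`r(C) ∈ k` — for every `σ ∈ Aut(L/k)` the cocycle `C⁻¹σ(C) ∈ Aut(W₁/L) = {1, [−1]}` gives
`σ(u) = ±u`, `σ(r) = r`. Hence the abscissa map `x ↦ u⁻²(x − r)` of the isomorphism is defined over
`k`, and the `x`-coordinates of `W₁[n]` and `W₂[n]` generate the same extension of `k`.
[cite: SilvermanAEC2009, Prop. X.5.4 and III.10 Thm. 10.1] -/
theorem VariableChange.exists_u_sq_eq_algebraMap_of_smul_baseChange (h2 : (2 : k) ≠ 0)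
    (h3 : (3 : k) ≠ 0) (hj0 : W₁.j ≠ 0) (hj : W₁.j ≠ 1728) (C : VariableChange L)
    (hC : C • W₁.baseChange L = W₂.baseChange L) :
    ∃ α β : k, α ≠ 0 ∧ ((C.u : L)) ^ 2 = algebraMap k L α ∧ C.r = algebraMap k L β := by
  haveI : (W₁.baseChange L).IsElliptic := inferInstanceAs (W₁.map (algebraMap k L)).IsElliptic
  have hinj := (algebraMap k L).injective
  have h2L : (2 : L) ≠ 0 := by rw [← map_ofNat (algebraMap k L) 2]; exact (map_ne_zero _).mpr h2
  have h3L : (3 : L) ≠ 0 := by rw [← map_ofNat (algebraMap k L) 3]; exact (map_ne_zero _).mpr h3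
  have hjL : (W₁.baseChange L).j = algebraMap k L W₁.j := W₁.map_j (algebraMap k L)
  have hj0L : (W₁.baseChange L).j ≠ 0 := by rw [hjL]; exact (map_ne_zero _).mpr hj0
  have hjL' : (W₁.baseChange L).j ≠ 1728 := by
    rw [hjL, ← map_ofNat (algebraMap k L) 1728]; exact fun h => hj (hinj h)
  -- for each `σ`: `σ(C) = C` or `σ(C) = C·[−1]`, hence `σ(u) = ±u`, `σ(r) = r`
  have key : ∀ σ : L ≃ₐ[k] L, (σ (C.u : L) = C.u ∨ σ (C.u : L) = -(C.u : L)) ∧ σ C.r = C.r := by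
    intro σ
    have hA := VariableChange.inv_mul_map_algEquiv_smul σ hC
    rcases VariableChange.eq_one_or_eq_neg_of_smul_eq (W₁.baseChange L) h2L h3L hj0L hjL' hA with
      h1 | hneg
    · -- `σ(C) = C`
      have hσC : C.map ((σ : L →ₐ[k] L) : L →+* L) = C := (inv_mul_eq_one.mp h1).symm
      have hu := congrArg (fun D : VariableChange L => (D.u : L)) hσC
      have hr := congrArg VariableChange.r hσC
      simp only [VariableChange.map, Units.coe_map, MonoidHom.coe_coe, RingHom.coe_coe] at hu hr
      exact ⟨Or.inl hu, hr⟩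
    · -- `σ(C) = C · [−1]`
      have hσC : C.map ((σ : L →ₐ[k] L) : L →+* L) =
          C * ⟨-1, 0, -(W₁.baseChange L).a₁, -(W₁.baseChange L).a₃⟩ := by
        rw [← hneg, mul_inv_cancel_left]
      have hu := congrArg (fun D : VariableChange L => (D.u : L)) hσC
      have hr := congrArg VariableChange.r hσC
      simp only [VariableChange.map, VariableChange.mul_def, Units.coe_map, MonoidHom.coe_coe,
        RingHom.coe_coe, Units.val_neg, Units.val_one, mul_neg, mul_one, neg_sq,
        one_pow, add_zero] at hu hr
      exact ⟨Or.inr hu, hr⟩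
  -- Galois descent of `u²` and `r`
  have hu2 : ∀ σ : L ≃ₐ[k] L, σ ((C.u : L) ^ 2) = (C.u : L) ^ 2 := fun σ => by
    rw [map_pow]
    rcases (key σ).1 with h | h
    · rw [h]
    · rw [h, neg_sq]
  obtain ⟨α, hα⟩ := (InfiniteGalois.mem_range_algebraMap_iff_fixed ((C.u : L) ^ 2)).mpr hu2
  obtain ⟨β, hβ⟩ := (InfiniteGalois.mem_range_algebraMap_iff_fixed C.r).mpr fun σ => (key σ).2
  refine ⟨α, β, ?_, hα.symm, hβ.symm⟩
  rintro rfl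
  rw [map_zero] at hα
  exact pow_ne_zero 2 C.u.ne_zero hα.symm

/-- **The abscissa of the isomorphism is `k`-rational** (same hypotheses): there are `α ≠ 0`, `β` in
`k` with `x(e_C(P)) = α⁻¹(x(P) − β)` for every affine point `P = (x, y)` of `W₁(L)` — so the
`x`-coordinates of corresponding points of the two `k`-models differ by a `k`-rational affine map
([IUTchIV] Prop. 1.8 (iii): the `2`-torsion field of "any model" is well defined).
[cite: SilvermanAEC2009, Prop. X.5.4 and III.1 Table 3.1] -/
theorem VariableChange.exists_toX_eq_affine_of_smul_baseChange (h2 : (2 : k) ≠ 0) (h3 : (3 : k) ≠ 0)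
    (hj0 : W₁.j ≠ 0) (hj : W₁.j ≠ 1728) (C : VariableChange L)
    (hC : C • W₁.baseChange L = W₂.baseChange L) :
    ∃ α β : k, α ≠ 0 ∧ ∀ x : L, C.toX x = (algebraMap k L α)⁻¹ * (x - algebraMap k L β) := by
  obtain ⟨α, β, hα0, hα, hβ⟩ :=
    VariableChange.exists_u_sq_eq_algebraMap_of_smul_baseChange W₁ W₂ h2 h3 hj0 hj C hC
  refine ⟨α, β, hα0, fun x => ?_⟩
  rw [VariableChange.toX_def, ← hβ, ← hα, Units.val_inv_eq_inv_val, inv_pow]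

end Descent

end WeierstrassCurve
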